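import Literature.Probability.Percolation.ZdLowestFrontierFeet
import Literature.Probability.Percolation.ZdFiveArmCounting
import HarnessLib

/-!
# The five-arm vertex of the lowest crossing gives the five-arm annulus event around it

Topic `Literature/Probability/Percolation`; bond percolation on `ℤ²`. PROOFS ONLY (no definition,
no named fact). Third file of the bond-`ℤ²` rendering of Nolin's construction (P. Nolin, EJP 13
(2008), §5.2, proof of Thm. 24 (ii) [arXiv 0711.4948: Thm. 23 (ii), p. 17]; site-`𝕋` twin:
`FiveArmArms.lean`, `FiveArmShift.lean`), on top of `ZdLowestFrontier.lean`,
`ZdLowestFrontierFeet.lean`: a vertex `π k` of the lowest crossing `π` of `R = [0,M] × [0,N]` which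
carries an attachment from the top side and which lies on every open left–right crossing of `R`
(pivotal; e.g. a double foot, `exists_doubleFoot`) is the centre of the five-arm event
`zdFiveArmClusters m n` (`ZdFourArmFromFiveArm.lean`) of every annulus `v + A_{m,n}` whose hole
contains `π k`, provided the two halves of `π` at `π k` and the top side of `R` reach beyond
`v + Λ_n` and `v + Λ_n` lies between the bottom and the top side of `R`:

* `exists_subwalk_sqAnnulus` — a lattice walk from the hole of `v + A_{m,n}` to the outside
  contains a sub-walk inside the annulus from `‖· - v‖ = m` to `‖· - v‖ = n`;
* `exists_walk_from_leftSide`, `exists_walk_to_rightSide` — cutting a walk at its last visit to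
  the left side / first visit to the right side of `R`;
* `relabel_shift_mem_zdFiveArmClusters_of_pivotal` — **the five-arm event around a pivotal
  attached vertex**: the three open arms are pieces of the two halves of `π` and of the
  attachment; the first two are not joined by an open path of the annulus, for such a path,
  completed by the two halves of `π` (and cut at the sides of `R` if the annulus sticks out of `R`
  horizontally), would be an open left–right crossing of `R` avoiding the pivotal vertex `π k`.

## References

* P. Nolin, EJP 13 (2008), §5.2, proof of Thm. 24 (ii) (arXiv 0711.4948: Thm. 23 (ii), p. 17)
  [Nolin2008].
* W. Werner, *Lectures on two-dimensional critical percolation*, PCMI (2009), first exercise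
  sheet, "Five-arm exponent" [WernerPCMI2009].

## Tree

`zdFiveArmClusters` (`ZdFourArmFromFiveArm.lean`), `siteSphere`, `sqAnnulus`
(`FourArmGarban.lean`), `BondConfig.relabel`, `sym2Equiv`, `Site.shift`
(`BondPercolationSymmetry.lean`), `relabel_mem_openConnIn`, `relabel_symm_relabel`
(`LatticeSymmetry.lean`), `exists_prefix_first_mem`, `exists_mem_support_apply_eq`
(`RSWLemma.lean`), `zdShiftIso` (`SiteConnectionTools.lean`).
-/

noncomputable section

open SimpleGraph Finset

namespace Literature.Probability.Percolation

open LatticeModels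

variable {M N : ℕ} {ω : BondConfig (Site 2)}

/-! ### Boxes around a centre -/

/-- Membership in a sphere from membership in consecutive boxes. [folklore] -/
theorem ZdFiveArmVertex.sub_mem_siteSphere_of {v x : Site 2} {r : ℕ} (hx : x - v ∈ box 2 r) (hx' : x - v ∉ box 2 (r - 1)) :
    x - v ∈ siteSphere r :=
  Finset.mem_sdiff.2 ⟨hx, hx'⟩

/-! ### A walk from the hole to the outside crosses the annulus -/

/-- **A lattice walk from the hole of the annulus `v + A_{m,n}` to its outside contains a sub-walk
inside the annulus from the inner sphere to the outer sphere** (its vertices and edges are among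
those of the walk). [folklore] -/
theorem exists_subwalk_sqAnnulus {v x y : Site 2} {m n : ℕ} (hm : 1 ≤ m) (hmn : m ≤ n)
    (W : (zdGraph 2).Walk x y) (hx : x - v ∈ box 2 (m - 1)) (hy : ∃ z ∈ W.support, z - v ∉ box 2 n) :
    ∃ (x' y' : Site 2) (W' : (zdGraph 2).Walk x' y'), x' - v ∈ siteSphere m ∧ y' - v ∈ siteSphere n ∧
      (∀ z ∈ W'.support, z - v ∈ sqAnnulus m n) ∧ (∀ z ∈ W'.support, z ∈ W.support) ∧
      ∀ e ∈ W'.edges, e ∈ W.edges := by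
  classical
  have hboxmono : ∀ {r r' : ℕ} {z : Site 2}, r ≤ r' → z ∈ box 2 r → z ∈ box 2 r' := by
    intro r r' z hrr' hz
    rw [mem_box] at hz ⊢
    intro i; have := hz i; constructor <;> omega
  -- (A) the prefix up to the first vertex outside `box (n-1)`
  obtain ⟨z₀, hz₀, hz₀n⟩ := hy
  obtain ⟨y', hy'O, W₁, hW₁s, hW₁e, hW₁d⟩ := exists_prefix_first_mem (O := {z : Site 2 | z - v ∉ box 2 (n - 1)}) W
    ⟨z₀, hz₀, fun h => hz₀n (hboxmono (Nat.sub_le n 1) h)⟩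
  have hy'O' : y' - v ∉ box 2 (n - 1) := hy'O
  -- every vertex of `W₁` is in `box n`
  have hfst : ∀ d ∈ W₁.darts, d.fst - v ∈ box 2 (n - 1) := fun d hd => by
    simpa only [Set.mem_setOf_eq, not_not] using hW₁d d hd
  have hW₁box : ∀ z ∈ W₁.support, z - v ∈ box 2 n := by
    intro z hz
    have h := W₁.map_fst_darts_append
    rw [← h, List.mem_append, List.mem_singleton] at hz
    rcases hz with hz | rfl
    · obtain ⟨d, hd, rfl⟩ := List.mem_map.1 hz
      exact hboxmono (Nat.sub_le n 1) (hfst d hd)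
    · -- the last vertex: `W₁` is not nil (its start is inside `box (m-1) ⊆ box (n-1)`)
      have hnil : ¬ W₁.Nil := by
        intro hn
        apply hy'O'
        rw [← hn.eq]
        exact hboxmono (by omega) hx
      obtain ⟨e, he, hze⟩ := (Walk.mem_support_iff_exists_mem_edges_of_not_nil hnil).1 W₁.end_mem_support
      rw [Walk.edges, List.mem_map] at he
      obtain ⟨d, hd, rfl⟩ := he
      have hd1 := hfst d hd
      rcases Sym2.mem_iff.1 hze with h1 | h1
      · rw [h1]; exact hboxmono (Nat.sub_le n 1) hd1
      · have := ZdPivotal.sub_mem_box_succ_of_adj hd1 d.adj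
        rw [← h1] at this
        rcases Nat.eq_zero_or_pos n with hn0 | hnpos
        · omega
        · rwa [Nat.sub_add_cancel hnpos] at this
  have hy'S : y' - v ∈ siteSphere n := ZdFiveArmVertex.sub_mem_siteSphere_of (hW₁box y' W₁.end_mem_support) hy'O'
  -- (B) on the reversed prefix, the first vertex inside `box m`
  obtain ⟨x', hx'O, W₂, hW₂s, hW₂e, hW₂d⟩ := exists_prefix_first_mem (O := {z : Site 2 | z - v ∈ box 2 m}) W₁.reverse
    ⟨x, by simp, hboxmono (Nat.sub_le m 1) hx⟩
  have hx'O' : x' - v ∈ box 2 m := hx'O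
  have hfst₂ : ∀ d ∈ W₂.darts, d.fst - v ∉ box 2 m := fun d hd => hW₂d d hd
  -- `x'` is not in `box (m-1)`
  have hx'S : x' - v ∈ siteSphere m := by
    refine ZdFiveArmVertex.sub_mem_siteSphere_of hx'O' fun hx'm => ?_
    by_cases hnil : W₂.Nil
    · -- then `x' = y'`, which is outside `box (n-1) ⊇ box (m-1)`
      have := hnil.eq
      apply hy'O'
      rw [this]
      exact hboxmono (by omega) hx'm
    · obtain ⟨e, he, hze⟩ := (Walk.mem_support_iff_exists_mem_edges_of_not_nil hnil).1 W₂.end_mem_support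
      rw [Walk.edges, List.mem_map] at he
      obtain ⟨d, hd, rfl⟩ := he
      have hd1 := hfst₂ d hd
      rcases Sym2.mem_iff.1 hze with h1 | h1
      · exact hd1 (h1 ▸ hboxmono (Nat.sub_le m 1) hx'm)
      · apply hd1
        have := ZdPivotal.sub_mem_box_succ_of_adj (h1 ▸ hx'm : d.snd - v ∈ box 2 (m - 1)) d.adj.symm
        rwa [Nat.sub_add_cancel hm] at this
  refine ⟨x', y', W₂.reverse, hx'S, hy'S, fun z hz => ?_, fun z hz => ?_, fun e he => ?_⟩
  · rw [Walk.support_reverse, List.mem_reverse] at hz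
    have hzW₁ : z ∈ W₁.support := by simpa using hW₂s z hz
    have hzn := hW₁box z hzW₁
    -- `z` is `x'` or the start of a dart of `W₂`, hence outside `box (m-1)`
    have hzm : z - v ∉ box 2 (m - 1) := by
      have h := W₂.map_fst_darts_append
      rw [← h, List.mem_append, List.mem_singleton] at hz
      rcases hz with hz | rfl
      · obtain ⟨d, hd, rfl⟩ := List.mem_map.1 hz
        exact fun h' => hfst₂ d hd (hboxmono (Nat.sub_le m 1) h')
      · exact (Finset.mem_sdiff.1 hx'S).2
    exact Finset.mem_coe.2 (mem_annulus.2 ⟨hzn, hzm⟩)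
  · rw [Walk.support_reverse, List.mem_reverse] at hz
    exact hW₁s z (by simpa using hW₂s z hz)
  · rw [Walk.edges_reverse, List.mem_reverse] at he
    exact hW₁e e (by simpa using hW₂e e he)

/-! ### Cutting a walk at the sides of `R` -/

/-- **Last visit to the left side.** A lattice walk ending at `q` with `0 ≤ q₀`, having a vertex with
first coordinate `≤ 0`, contains a final piece from a vertex of the line `x₀ = 0` to `q` all of whose
vertices have `x₀ ≥ 0`. [folklore] -/
theorem exists_walk_from_leftSide {p q : Site 2} (Q : (zdGraph 2).Walk p q) (hq : 0 ≤ q 0)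
    (hz : ∃ z ∈ Q.support, z 0 ≤ 0) :
    ∃ (q₀ : Site 2) (S : (zdGraph 2).Walk q₀ q), q₀ 0 = 0 ∧ (∀ w ∈ S.support, w ∈ Q.support) ∧
      (∀ e ∈ S.edges, e ∈ Q.edges) ∧ ∀ w ∈ S.support, 0 ≤ w 0 := by
  classical
  -- a vertex on the line `x₀ = 0`
  obtain ⟨z, hz, hz0⟩ := hz
  obtain ⟨w₀, hw₀, hw₀0⟩ := exists_mem_support_apply_eq (Q.dropUntil z hz) 0 0 hz0 hq
  have hw₀Q : w₀ ∈ Q.support := Q.support_dropUntil_subset_support hz hw₀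
  -- the first visit of `Q.reverse` to the line
  obtain ⟨q₀, hq₀O, S, hSs, hSe, hSd⟩ :=
    exists_prefix_first_mem (O := {w : Site 2 | w 0 = 0}) Q.reverse ⟨w₀, by simpa using hw₀Q, hw₀0⟩
  have hq₀0 : q₀ 0 = 0 := hq₀O
  refine ⟨q₀, S.reverse, hq₀0, fun w hw => ?_, fun e he => ?_, fun w hw => ?_⟩
  · have := hSs w (by simpa using hw); simpa using this
  · have := hSe e (by simpa using he); simpa using this
  · rw [Walk.support_reverse, List.mem_reverse] at hw
    by_contra hneg
    push Not at hneg
    -- between `q` (x ≥ 0) and `w` (x < 0) along `S` there is a vertex of the line, which must be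
    -- the last vertex `q₀` of `S`; but it occurs before `w`
    obtain ⟨u, hu, hu0⟩ := exists_mem_support_apply_eq (S.takeUntil w hw).reverse 0 0 hneg.le hq
    rw [Walk.support_reverse, List.mem_reverse] at hu
    have huS : u ∈ (S.takeUntil w hw).support := hu
    -- vertices of `S.takeUntil w` other than `w` start darts of `S`, hence are off the line
    have h := (S.takeUntil w hw).map_fst_darts_append
    rw [← h, List.mem_append, List.mem_singleton] at huS
    rcases huS with huS | rfl
    · obtain ⟨d, hd, rfl⟩ := List.mem_map.1 huS
      exact hSd d (S.darts_takeUntil_subset_darts hw hd) hu0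
    · omega

/-- **First visit to the right side.** A lattice walk starting at `p` with `p₀ ≤ M`, having a
vertex with first coordinate `≥ M`, contains an initial piece from `p` to a vertex of the line
`x₀ = M` all of whose vertices have `x₀ ≤ M`. [folklore] -/
theorem exists_walk_to_rightSide {p q : Site 2} (Q : (zdGraph 2).Walk p q) (hp : p 0 ≤ M)
    (hz : ∃ z ∈ Q.support, (M : ℤ) ≤ z 0) :
    ∃ (q₁ : Site 2) (S : (zdGraph 2).Walk p q₁), q₁ 0 = M ∧ (∀ w ∈ S.support, w ∈ Q.support) ∧
      (∀ e ∈ S.edges, e ∈ Q.edges) ∧ ∀ w ∈ S.support, w 0 ≤ M := by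
  classical
  obtain ⟨z, hz, hzM⟩ := hz
  obtain ⟨w₁, hw₁, hw₁M⟩ := exists_mem_support_apply_eq (Q.takeUntil z hz) 0 M hp hzM
  have hw₁Q : w₁ ∈ Q.support := Q.support_takeUntil_subset_support hz hw₁
  obtain ⟨q₁, hq₁O, S, hSs, hSe, hSd⟩ :=
    exists_prefix_first_mem (O := {w : Site 2 | w 0 = (M : ℤ)}) Q ⟨w₁, hw₁Q, hw₁M⟩
  have hq₁M : q₁ 0 = M := hq₁O
  refine ⟨q₁, S, hq₁M, hSs, hSe, fun w hw => ?_⟩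
  by_contra hgt
  push Not at hgt
  obtain ⟨u, hu, huM⟩ := exists_mem_support_apply_eq (S.takeUntil w hw) 0 M hp hgt.le
  have h := (S.takeUntil w hw).map_fst_darts_append
  rw [← h, List.mem_append, List.mem_singleton] at hu
  rcases hu with hu | rfl
  · obtain ⟨d, hd, rfl⟩ := List.mem_map.1 hu
    exact hSd d (S.darts_takeUntil_subset_darts hw hd) huM
  · omega

/-! ### Shifting walks to the origin -/

/-- The translation by `-v` as a graph homomorphism of `ℤ²`. [folklore] -/
theorem exists_map_shift_walk (v : Site 2) {x y : Site 2} (W : (zdGraph 2).Walk x y) :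
    ∃ W' : (zdGraph 2).Walk (x - v) (y - v),
      (∀ z, z ∈ W'.support ↔ z + v ∈ W.support) ∧
      (∀ p q : Site 2, s(p, q) ∈ W'.edges ↔ s(p + v, q + v) ∈ W.edges) := by
  set f := (zdShiftIso (-v : Site 2)).toEmbedding.toHom with hf
  have hfx : ∀ z : Site 2, f z = z - v := fun z => by simp [hf, sub_eq_add_neg]
  refine ⟨(W.map f).copy (hfx x) (hfx y), fun z => ?_, fun p q => ?_⟩
  · rw [Walk.support_copy, Walk.support_map, List.mem_map]
    constructor
    · rintro ⟨w, hw, rfl⟩; rw [hfx, sub_add_cancel]; exact hw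
    · intro h; exact ⟨z + v, h, by rw [hfx, add_sub_cancel_right]⟩
  · rw [Walk.edges_copy, Walk.edges_map, List.mem_map]
    constructor
    · rintro ⟨e, he, hpe⟩
      induction e using Sym2.ind with
      | h a' b' =>
        rw [Sym2.map_mk, hfx, hfx, Sym2.eq_iff] at hpe
        rcases hpe with ⟨h1, h2⟩ | ⟨h1, h2⟩
        · rw [← h1, ← h2, sub_add_cancel, sub_add_cancel]; exact he
        · rw [← h1, ← h2, sub_add_cancel, sub_add_cancel, Sym2.eq_swap]; exact he
    · intro h
      exact ⟨s(p + v, q + v), h, by rw [Sym2.map_mk, hfx, hfx, add_sub_cancel_right, add_sub_cancel_right]⟩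

/-- Open edges of `ω` seen from `v`: `s(p, q)` is open in the configuration translated by `-v` iff
`s(p + v, q + v)` is open in `ω`. [folklore] -/
theorem mk_mem_relabel_shift_neg_iff (v : Site 2) (ω : BondConfig (Site 2)) (p q : Site 2) :
    s(p, q) ∈ BondConfig.relabel (sym2Equiv (Site.shift (-v))) ω ↔ s(p + v, q + v) ∈ ω := by
  have := mk_mem_relabel_iff (Site.shift (-v)) ω (p + v) (q + v)
  simp only [Site.shift_apply, add_neg_cancel_right] at this
  exact this

/-- Undoing the translation: `ω` translated by `-v` and then by `v` is `ω`. [folklore] -/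
theorem relabel_shift_relabel_shift_neg (v : Site 2) (ω : BondConfig (Site 2)) :
    BondConfig.relabel (sym2Equiv (Site.shift v)) (BondConfig.relabel (sym2Equiv (Site.shift (-v))) ω) = ω := by
  have hsymm : (Site.shift (-v)).symm = Site.shift v := by
    ext x i; simp [sub_neg_eq_add]
  rw [← hsymm]
  exact relabel_symm_relabel (Site.shift (-v)) ω

/-! ### The five-arm event around a pivotal attached vertex of the lowest crossing -/

/-- **The five-arm annulus event around a pivotal attached vertex of the lowest crossing** (Nolin
2008, proof of Thm. 24 (ii): "any site on this crossing has already 3 arms, 2 black and 1 white…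
[with the black path to the top side and] a white arm from `v` to the top side", read for bond
percolation on `ℤ²` through the cluster form `zdFiveArmClusters`).  Let `π` be the lowest crossing
of `R = [0,M] × [0,N]`, `π k` a vertex of it carrying an attachment from the top side and lying on
every open left–right crossing of `R`.  Let `v + A_{m,n}` (`1 ≤ m ≤ n`, `2n + 1 ≤ M`) be an annulus
whose hole `v + Λ_{m-1}` contains `π k`, such that both halves of `π` at `π k` leave `v + Λ_n`,
and `n ≤ v₁`, `v₁ + n < N`.  Then the configuration seen from `v` lies in `zdFiveArmClusters m n`:
the arms are the pieces across the annulus of the two halves of `π` and of the attachment (whose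
edges, joining above vertices, are not edges of `π`); and an open path of the annulus joining the
inner ends of the first two, completed by the outer pieces of the two halves (cut at its last visit
to the left side or first visit to the right side of `R` when the annulus sticks out of `R`), would
be an open left–right crossing of `R` avoiding `π k`. [cite: Nolin2008, §5.2, proof of Thm. 24 (ii) (arXiv 0711.4948: Thm. 23 (ii), p. 17)] -/
theorem relabel_shift_mem_zdFiveArmClusters_of_pivotal (hω : ω ⊆ (zdGraph 2).edgeSet)
    {a b : Site 2} (π : (zdGraph 2).Walk a b) (hπ : π.IsPath)
    (hends : (a 0 = 0 ∧ b 0 = M) ∨ (a 0 = M ∧ b 0 = 0))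
    (hR : ∀ z ∈ π.support, z ∈ rectangle M N) (hE : ∀ e, e ∈ π.edges ↔ IsLowEdge M N ω e)
    {k : ℕ} (hk : k ≤ π.length) (hatt : IsAttachedLow M N ω (π.getVert k))
    (hpiv : ∀ {a' b' : Site 2} (P : (zdGraph 2).Walk a' b'), (∀ z ∈ P.support, z ∈ rectangle M N) →
      ((a' 0 = 0 ∧ b' 0 = M) ∨ (a' 0 = M ∧ b' 0 = 0)) → (∀ e ∈ P.edges, e ∈ ω) → π.getVert k ∈ P.support)
    {v : Site 2} {m n : ℕ} (hm : 1 ≤ m) (hmn : m ≤ n) (hMn : 2 * (n : ℤ) + 1 ≤ M)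
    (hc : π.getVert k - v ∈ box 2 (m - 1))
    (hfar₁ : ∃ z ∈ (π.drop k).support, z - v ∉ box 2 n)
    (hfar₂ : ∃ z ∈ (π.take k).support, z - v ∉ box 2 n)
    (hlo : (n : ℤ) ≤ v 1) (hhi : v 1 + n < N) :
    BondConfig.relabel (sym2Equiv (Site.shift (-v))) ω ∈ zdFiveArmClusters m n := by
  classical
  -- preliminaries on `π`
  have hnil : ¬ π.Nil := by
    intro h; have := h.eq; subst this
    rcases hends with ⟨h1, h2⟩ | ⟨h1, h2⟩ <;> omega
  have hsupp : ∀ z, z ∈ π.support ↔ IsLowVertex M N ω z := by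
    intro z
    rw [Walk.mem_support_iff_exists_mem_edges_of_not_nil hnil]
    exact ⟨fun ⟨e, he, hze⟩ => ⟨e, (hE e).1 he, hze⟩, fun ⟨e, he, hze⟩ => ⟨e, (hE e).2 he, hze⟩⟩
  have hinj : ∀ {i j : ℕ}, i ≤ π.length → j ≤ π.length → π.getVert i = π.getVert j → i = j :=
    fun hi hj h => hπ.getVert_injOn hi hj h
  have hπω : ∀ e ∈ π.edges, e ∈ ω := fun e he => ((hE e).1 he).mem hω
  have hAboveNot : ∀ {z : Site 2}, IsAboveVertex M N ω z → z ∉ π.support :=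
    fun hz hzs => hz.2.1 ((hsupp _).1 hzs)
  have hκR : ∀ i, π.getVert i ∈ rectangle M N := fun i => hR _ (π.getVert_mem_support i)
  -- geometry of the annulus around `v`
  have hboxn : ∀ {z : Site 2}, z - v ∈ sqAnnulus m n → z - v ∈ box 2 n := fun hz =>
    (mem_annulus.1 (Finset.mem_coe.1 hz)).1
  have hnotk : ∀ {z : Site 2}, z - v ∈ sqAnnulus m n → z ≠ π.getVert k := by
    intro z hz hzk
    subst hzk
    exact (mem_annulus.1 (Finset.mem_coe.1 hz)).2 hc
  have hsphk : ∀ {z : Site 2}, z - v ∈ siteSphere m → z ≠ π.getVert k := by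
    intro z hz hzk
    subst hzk
    exact (Finset.mem_sdiff.1 hz).2 hc
  have hycoord : ∀ {z : Site 2}, z - v ∈ box 2 n → 0 ≤ z 1 ∧ z 1 ≤ N := by
    intro z hz
    have := (mem_box.1 hz) 1
    simp only [Pi.sub_apply] at this
    omega
  -- the attachment `U' : t₀ → t → π k`
  obtain ⟨t, ⟨t₀, ht₀, U, hUa, hUe⟩, hti, htiω⟩ := hatt
  have ht₀N : t₀ 1 = N := (Finset.mem_filter.1 ht₀).2
  set U' : (zdGraph 2).Walk t₀ (π.getVert k) := U.concat hti with hU'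
  have hU'e : ∀ e ∈ U'.edges, e ∈ ω := by
    intro e he
    rw [hU', Walk.edges_concat, List.concat_eq_append, List.mem_append, List.mem_singleton] at he
    rcases he with he | rfl
    exacts [hUe e he, htiω]
  -- an edge of the attachment is not an edge of `π`
  have hU'π : ∀ e ∈ U'.edges, e ∉ π.edges := by
    intro e he heπ
    rw [hU', Walk.edges_concat, List.concat_eq_append, List.mem_append, List.mem_singleton] at he
    rcases he with he | rfl
    · induction e using Sym2.ind with
      | h x y => exact hAboveNot (hUa x (U.fst_mem_support_of_mem_edges he)) (π.fst_mem_support_of_mem_edges heπ)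
    · exact hAboveNot (hUa t U.end_mem_support) (π.fst_mem_support_of_mem_edges heπ)
  -- (1) the three arms in `ω`
  obtain ⟨x₁, y₁, W₁, hx₁, hy₁, hW₁a, hW₁s, hW₁e⟩ := exists_subwalk_sqAnnulus hm hmn (π.drop k) hc hfar₁
  obtain ⟨x₂, y₂, W₂, hx₂, hy₂, hW₂a, hW₂s, hW₂e⟩ := exists_subwalk_sqAnnulus hm hmn (π.take k).reverse hc
    (by obtain ⟨z, hz, hzn⟩ := hfar₂; exact ⟨z, by simpa using hz, hzn⟩)
  obtain ⟨x₃, y₃, W₃, hx₃, hy₃, hW₃a, hW₃s, hW₃e⟩ := exists_subwalk_sqAnnulus hm hmn U'.reverse hc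
    ⟨t₀, by simp, fun h => by have := (mem_box.1 h) 1; simp only [Pi.sub_apply] at this; omega⟩
  have hW₁π : ∀ e ∈ W₁.edges, e ∈ π.edges := fun e he => edges_drop_subset π k (hW₁e e he)
  have hW₂π : ∀ e ∈ W₂.edges, e ∈ π.edges := fun e he =>
    edges_take_subset π k (by simpa using hW₂e e he)
  have hW₃U : ∀ e ∈ W₃.edges, e ∈ U'.edges := fun e he => by simpa using hW₃e e he
  -- (2) shift to the origin
  set ω' := BondConfig.relabel (sym2Equiv (Site.shift (-v))) ω with hω'
  obtain ⟨V₁, hV₁s, hV₁e⟩ := exists_map_shift_walk v W₁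
  obtain ⟨V₂, hV₂s, hV₂e⟩ := exists_map_shift_walk v W₂
  obtain ⟨V₃, hV₃s, hV₃e⟩ := exists_map_shift_walk v W₃
  have hopen : ∀ {x y : Site 2} {W : (zdGraph 2).Walk x y} {V : (zdGraph 2).Walk (x - v) (y - v)},
      (∀ p q : Site 2, s(p, q) ∈ V.edges ↔ s(p + v, q + v) ∈ W.edges) → (∀ e ∈ W.edges, e ∈ ω) →
      ∀ e ∈ V.edges, e ∈ ω' := by
    intro x y W V hVe hWω e he
    induction e using Sym2.ind with
    | h p q => exact (mk_mem_relabel_shift_neg_iff v ω p q).2 (hWω _ ((hVe p q).1 he))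
  have hsupp' : ∀ {x y : Site 2} {W : (zdGraph 2).Walk x y} {V : (zdGraph 2).Walk (x - v) (y - v)},
      (∀ z, z ∈ V.support ↔ z + v ∈ W.support) → (∀ z ∈ W.support, z - v ∈ sqAnnulus m n) →
      ∀ z ∈ V.support, z ∈ sqAnnulus m n := by
    intro x y W V hVs hWa z hz
    have := hWa _ ((hVs z).1 hz)
    rwa [add_sub_cancel_right] at this
  have hdisj : ∀ {x y x' y' : Site 2} {W : (zdGraph 2).Walk x y} {V : (zdGraph 2).Walk (x - v) (y - v)}
      {W' : (zdGraph 2).Walk x' y'} {V' : (zdGraph 2).Walk (x' - v) (y' - v)},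
      (∀ p q : Site 2, s(p, q) ∈ V.edges ↔ s(p + v, q + v) ∈ W.edges) →
      (∀ p q : Site 2, s(p, q) ∈ V'.edges ↔ s(p + v, q + v) ∈ W'.edges) →
      (∀ e ∈ W.edges, e ∈ π.edges) → (∀ e ∈ W'.edges, e ∈ U'.edges) →
      ∀ e ∈ V.edges, e ∉ V'.edges := by
    intro x y x' y' W V W' V' hVe hV'e hWπ hW'U e he he'
    induction e using Sym2.ind with
    | h p q => exact hU'π _ (hW'U _ ((hV'e p q).1 he')) (hWπ _ ((hVe p q).1 he))
  refine ⟨x₁ - v, x₂ - v, x₃ - v, y₁ - v, y₂ - v, y₃ - v, V₁, V₂, V₃, hx₁, hx₂, hx₃, hy₁, hy₂, hy₃,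
    hsupp' hV₁s hW₁a, hsupp' hV₂s hW₂a, hsupp' hV₃s hW₃a, hopen hV₁e (fun e he => hπω e (hW₁π e he)),
    hopen hV₂e (fun e he => hπω e (hW₂π e he)), hopen hV₃e (fun e he => hU'e e (hW₃U e he)),
    hdisj hV₁e hV₃e hW₁π hW₃U, hdisj hV₂e hV₃e hW₂π hW₃U, fun hconn => ?_⟩
  -- (3) no open path of the annulus joins `x₁ - v` to `x₂ - v`: back in `ω`, such a path `Q`
  have hconn' : ω ∈ openConnIn (Site.shift v '' sqAnnulus m n) x₁ x₂ := by
    have := relabel_mem_openConnIn (Site.shift v) hconn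
    rw [relabel_shift_relabel_shift_neg] at this
    simpa using this
  obtain ⟨Q, hQs, hQe⟩ := exists_walk_of_mem_openConnIn hω hconn'
  have hQa : ∀ z ∈ Q.support, z - v ∈ sqAnnulus m n := by
    intro z hz
    have := (Set.mem_image_equiv).1 (hQs z hz)
    simpa using this
  have hQy : ∀ z ∈ Q.support, 0 ≤ z 1 ∧ z 1 ≤ N := fun z hz => hycoord (hboxn (hQa z hz))
  have hQk : ∀ z ∈ Q.support, z ≠ π.getVert k := fun z hz => hnotk (hQa z hz)
  -- indices of `x₁`, `x₂` on `π`
  obtain ⟨m₁, hkm₁, hm₁L, hm₁⟩ := exists_getVert_of_mem_support_drop π hk (hW₁s x₁ W₁.start_mem_support)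
  obtain ⟨m₂, hm₂k, hm₂L, hm₂⟩ := exists_getVert_of_mem_support_take π k
    (by simpa using hW₂s x₂ W₂.start_mem_support : x₂ ∈ (π.take k).support)
  have hm₁k : k < m₁ := by
    rcases eq_or_lt_of_le hkm₁ with h | h
    · exact absurd (hm₁ ▸ h ▸ rfl) (hsphk hx₁)
    · exact h
  have hm₂k' : m₂ < k := by
    rcases eq_or_lt_of_le hm₂k with h | h
    · exact absurd (hm₂ ▸ h ▸ rfl) (hsphk hx₂)
    · exact h
  subst hm₁; subst hm₂
  -- the outer pieces of the two halves avoid `π k`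
  have hπRk : π.getVert k ∉ (π.drop m₁).support := by
    intro h
    obtain ⟨i, hi, hiL, hieq⟩ := exists_getVert_of_mem_support_drop π hm₁L h
    have := hinj hiL hk hieq; omega
  have hπLk : π.getVert k ∉ (π.take m₂).support := by
    intro h
    obtain ⟨i, hi, hiL, hieq⟩ := exists_getVert_of_mem_support_take π m₂ h
    have := hinj hiL hk hieq; omega
  have hπRs : ∀ z ∈ (π.drop m₁).support, z ∈ rectangle M N := fun z hz => by
    obtain ⟨i, -, -, rfl⟩ := exists_getVert_of_mem_support_drop π hm₁L hz; exact hκR i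
  have hπLs : ∀ z ∈ (π.take m₂).support, z ∈ rectangle M N := fun z hz => by
    obtain ⟨i, -, -, rfl⟩ := exists_getVert_of_mem_support_take π m₂ hz; exact hκR i
  have hπRe : ∀ e ∈ (π.drop m₁).edges, e ∈ ω := fun e he => hπω e (edges_drop_subset π m₁ he)
  have hπLe : ∀ e ∈ (π.take m₂).edges, e ∈ ω := fun e he => hπω e (edges_take_subset π m₂ he)
  have hx₁R := mem_rectangle_iff.1 (hκR m₁)
  have hx₂R := mem_rectangle_iff.1 (hκR m₂)
  -- case analysis on whether `Q` stays inside `R` horizontally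
  by_cases hin : ∀ z ∈ Q.support, 0 ≤ z 0 ∧ z 0 ≤ M
  · -- `π[0,m₂] + Q⁻¹ + π[m₁,L]` is an open left–right walk avoiding `π k`
    set P : (zdGraph 2).Walk a b := (π.take m₂).append (Q.reverse.append (π.drop m₁)) with hP
    have hPs : ∀ z ∈ P.support, z ∈ rectangle M N := by
      intro z hz
      rw [hP, Walk.mem_support_append_iff, Walk.mem_support_append_iff, Walk.support_reverse,
        List.mem_reverse] at hz
      rcases hz with hz | hz | hz
      · exact hπLs z hz
      · exact mem_rectangle_iff.2 ⟨(hin z hz).1, (hin z hz).2, (hQy z hz).1, (hQy z hz).2⟩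
      · exact hπRs z hz
    have hPe : ∀ e ∈ P.edges, e ∈ ω := by
      intro e he
      rw [hP, Walk.edges_append, List.mem_append, Walk.edges_append, List.mem_append, Walk.edges_reverse,
        List.mem_reverse] at he
      rcases he with he | he | he
      exacts [hπLe e he, hQe e he, hπRe e he]
    have := hpiv P hPs hends hPe
    rw [hP, Walk.mem_support_append_iff, Walk.mem_support_append_iff, Walk.support_reverse,
      List.mem_reverse] at this
    rcases this with h | h | h
    exacts [hπLk h, hQk _ h rfl, hπRk h]
  · push Not at hin
    obtain ⟨z₀, hz₀, hz₀x⟩ := hin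
    have hz₀a := hQa z₀ hz₀
    have hz₀box := (mem_box.1 (hboxn hz₀a)) 0
    simp only [Pi.sub_apply] at hz₀box
    by_cases hneg : z₀ 0 < 0
    · -- the annulus sticks out on the left: all its points have `x₀ ≤ M`
      have hxle : ∀ z ∈ Q.support, z 0 ≤ M := by
        intro z hz
        have := (mem_box.1 (hboxn (hQa z hz))) 0
        simp only [Pi.sub_apply] at this
        omega
      rcases hends with ⟨ha0, hbM⟩ | ⟨haM, hb0⟩
      · -- from the left side along `Q⁻¹` to `π m₁`, then `π[m₁,L]` to `b`
        obtain ⟨q₀, S, hq₀, hSs, hSe, hSx⟩ := exists_walk_from_leftSide Q.reverse hx₁R.1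
          ⟨z₀, by simpa using hz₀, hneg.le⟩
        set P : (zdGraph 2).Walk q₀ b := S.append (π.drop m₁) with hP
        have hPs : ∀ z ∈ P.support, z ∈ rectangle M N := by
          intro z hz
          rw [hP, Walk.mem_support_append_iff] at hz
          rcases hz with hz | hz
          · have hzQ : z ∈ Q.support := by simpa using hSs z hz
            exact mem_rectangle_iff.2 ⟨hSx z hz, hxle z hzQ, (hQy z hzQ).1, (hQy z hzQ).2⟩
          · exact hπRs z hz
        have hPe : ∀ e ∈ P.edges, e ∈ ω := by
          intro e he
          rw [hP, Walk.edges_append, List.mem_append] at he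
          rcases he with he | he
          · exact hQe e (by simpa using hSe e he)
          · exact hπRe e he
        have := hpiv P hPs (Or.inl ⟨hq₀, hbM⟩) hPe
        rw [hP, Walk.mem_support_append_iff] at this
        rcases this with h | h
        · exact hQk _ (by simpa using hSs _ h) rfl
        · exact hπRk h
      · -- from the left side along `Q` to `π m₂`, then `π[0,m₂]⁻¹` to `a`
        obtain ⟨q₀, S, hq₀, hSs, hSe, hSx⟩ := exists_walk_from_leftSide Q hx₂R.1 ⟨z₀, hz₀, hneg.le⟩
        set P : (zdGraph 2).Walk q₀ a := S.append (π.take m₂).reverse with hP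
        have hPs : ∀ z ∈ P.support, z ∈ rectangle M N := by
          intro z hz
          rw [hP, Walk.mem_support_append_iff, Walk.support_reverse, List.mem_reverse] at hz
          rcases hz with hz | hz
          · have hzQ : z ∈ Q.support := hSs z hz
            exact mem_rectangle_iff.2 ⟨hSx z hz, hxle z hzQ, (hQy z hzQ).1, (hQy z hzQ).2⟩
          · exact hπLs z hz
        have hPe : ∀ e ∈ P.edges, e ∈ ω := by
          intro e he
          rw [hP, Walk.edges_append, List.mem_append, Walk.edges_reverse, List.mem_reverse] at he
          rcases he with he | he
          · exact hQe e (hSe e he)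
          · exact hπLe e he
        have := hpiv P hPs (Or.inl ⟨hq₀, haM⟩) hPe
        rw [hP, Walk.mem_support_append_iff, Walk.support_reverse, List.mem_reverse] at this
        rcases this with h | h
        · exact hQk _ (hSs _ h) rfl
        · exact hπLk h
    · -- the annulus sticks out on the right: all its points have `x₀ ≥ 0`
      have hz₀M : (M : ℤ) < z₀ 0 := hz₀x (by omega)
      have hxge : ∀ z ∈ Q.support, 0 ≤ z 0 := by
        intro z hz
        have := (mem_box.1 (hboxn (hQa z hz))) 0
        simp only [Pi.sub_apply] at this
        omega
      rcases hends with ⟨ha0, hbM⟩ | ⟨haM, hb0⟩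
      · -- `π[0,m₂]` from `a` to `π m₂`, then along `Q⁻¹` to the right side
        obtain ⟨q₁, S, hq₁, hSs, hSe, hSx⟩ := exists_walk_to_rightSide (M := M) Q.reverse hx₂R.2.1
          ⟨z₀, by simpa using hz₀, hz₀M.le⟩
        set P : (zdGraph 2).Walk a q₁ := (π.take m₂).append S with hP
        have hPs : ∀ z ∈ P.support, z ∈ rectangle M N := by
          intro z hz
          rw [hP, Walk.mem_support_append_iff] at hz
          rcases hz with hz | hz
          · exact hπLs z hz
          · have hzQ : z ∈ Q.support := by simpa using hSs z hz
            exact mem_rectangle_iff.2 ⟨hxge z hzQ, hSx z hz, (hQy z hzQ).1, (hQy z hzQ).2⟩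
        have hPe : ∀ e ∈ P.edges, e ∈ ω := by
          intro e he
          rw [hP, Walk.edges_append, List.mem_append] at he
          rcases he with he | he
          · exact hπLe e he
          · exact hQe e (by simpa using hSe e he)
        have := hpiv P hPs (Or.inl ⟨ha0, hq₁⟩) hPe
        rw [hP, Walk.mem_support_append_iff] at this
        rcases this with h | h
        · exact hπLk h
        · exact hQk _ (by simpa using hSs _ h) rfl
      · -- `π[m₁,L]⁻¹` from `b` to `π m₁`, then along `Q` to the right side
        obtain ⟨q₁, S, hq₁, hSs, hSe, hSx⟩ := exists_walk_to_rightSide (M := M) Q hx₁R.2.1 ⟨z₀, hz₀, hz₀M.le⟩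
        set P : (zdGraph 2).Walk b q₁ := (π.drop m₁).reverse.append S with hP
        have hPs : ∀ z ∈ P.support, z ∈ rectangle M N := by
          intro z hz
          rw [hP, Walk.mem_support_append_iff, Walk.support_reverse, List.mem_reverse] at hz
          rcases hz with hz | hz
          · exact hπRs z hz
          · have hzQ : z ∈ Q.support := hSs z hz
            exact mem_rectangle_iff.2 ⟨hxge z hzQ, hSx z hz, (hQy z hzQ).1, (hQy z hzQ).2⟩
        have hPe : ∀ e ∈ P.edges, e ∈ ω := by
          intro e he
          rw [hP, Walk.edges_append, List.mem_append, Walk.edges_reverse, List.mem_reverse] at he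
          rcases he with he | he
          · exact hπRe e he
          · exact hQe e (hSe e he)
        have := hpiv P hPs (Or.inl ⟨hb0, hq₁⟩) hPe
        rw [hP, Walk.mem_support_append_iff, Walk.support_reverse, List.mem_reverse] at this
        rcases this with h | h
        · exact hπRk h
        · exact hQk _ (hSs _ h) rfl

end Literature.Probability.Percolation

end
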